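import Literature.NumberTheory.Transcendental.ZilberField
import Literature.NumberTheory.Transcendental.GammaFieldsEclTransfer
import Literature.NumberTheory.Transcendental.ZilberQuasiminimalProofs
import Literature.NumberTheory.Transcendental.ZilberQuasiminimalReduction
import HarnessLib

/-!
# Quasiminimality of Zilber fields from Bays–Kirby 2018, Props 11.2 + 11.5 (all universes)

Sibling file of `Literature/NumberTheory/Transcendental/ZilberField.lean` for the named fact
`Literature.NumberTheory.Transcendental.IsZilberField.isQuasiminimal` (B. Zilber, *Pseudo-exponentiation on
algebraically closed fields of characteristic zero*, Ann. Pure Appl. Logic 132 (2005), Thm 1.2;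
complete proof: M. Bays, J. Kirby, *Pseudo-exponential maps, variants, and quasiminimality*,
Algebra & Number Theory 12 (2018), Thm 1.2 = Thm 9.1): **every Zilber field is quasiminimal**.

A Zilber field is in particular a *full* Γ-field (algebraically closed, `exp` onto `Fˣ`) with the
countable closure property which is exponentially-algebraically closed (strong
exponential-algebraic closedness implies exponential-algebraic closedness,
`IsStronglyExpAlgClosed.isExpAlgClosed`), so Bays–Kirby's Cor. 11.7 (exponential case: "a full
Γ-field with the countable closure property which is Γ-closed is quasiminimal", the named fact
`Literature.NumberTheory.Transcendental.BaysKirby2018_isQuasiminimal_of_isExpAlgClosed_of_ccp`) applies to it. The tree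
proves Cor. 11.7 (`ZilberQuasiminimalProofs.lean`, `ZilberQuasiminimalReduction.lean`) from
Bays–Kirby's Props 11.5 and 11.2 (`Literature.NumberTheory.Transcendental.BaysKirby2018_prop_11_5`,
`Literature.NumberTheory.Transcendental.BaysKirby2018_prop_11_2`, named facts) — but only for fields in `Type`, because
Γ-closedness of `ecl`-closed sets was taken there from Ax's theorem `ax_schanuel`, which is
stated in universe `0`. The named fact `IsZilberField.isQuasiminimal` quantifies over fields in an
arbitrary universe. This file removes the restriction and performs the assembly:

* the Karp/back-and-forth engine of `ZilberQuasiminimalProofs.lean` (Bays–Kirby, proofs of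
  Thm 6.9 and Thm 11.6) is re-run in an arbitrary universe with the **one-point extension
  property** of Γ-isomorphisms over `K` as an explicit hypothesis
  (`GammaField.exists_state_realize_term_of_extension`,
  `GammaField.isBackAndForth_gammaIso_of_extension`,
  `GammaField.isQuasiminimal_of_ccp_of_extension`), Γ-closedness of `ecl C` for countable `C`
  being supplied in all universes by the countable closure property
  (`GammaField.isGammaClosed_span_ecl_of_countable`, `GammaFieldsEclTransfer.lean`);
* the one-point extension property follows from `ℵ₀`-saturation for Γ-algebraic extensions over
  `K` (the hull dichotomy, `GammaField.IsGammaIso.exists_extension_of_ccp`, as in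
  `GammaField.IsGammaIso.exists_extension`);
* hence Cor. 11.7 (exponential case) in every universe from the saturation fact
  (`BaysKirby2018_isQuasiminimal_of_isExpAlgClosed_of_ccp_of_saturation_univ`) and from
  Props 11.5 + 11.2 (`…_of_props_univ`), and the reductions of the target fact:
  `IsZilberField.isQuasiminimal_of_cor_11_7`,
  `IsZilberField.isQuasiminimal_of_saturation_of_isExpAlgClosed`,
  `IsZilberField.isQuasiminimal_of_props :
    BaysKirby2018_prop_11_5.{u} → BaysKirby2018_prop_11_2.{u} → IsZilberField.isQuasiminimal.{u}`,
  together with the hypothesis-local forms `IsZilberField.isQuasiminimal_of_extension` and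
  `IsZilberField.isQuasiminimal_of_saturatedOver` (saturation over `ecl ∅` of each uncountable
  Zilber field suffices);
* the route avoiding a named weak Zilber–Pink input: `IsZilberField.isQuasiminimal_of_prop_11_2`
  (Prop. 11.2 + generic strong Γ-closedness of uncountable Zilber fields over `ecl ∅` suffice)
  and `IsZilberField.isGenericallyStronglyGammaClosedOver_of_prop_11_5` (that hypothesis from
  Prop. 11.5, for the record).

After this file, `IsZilberField.isQuasiminimal` (Zilber fields) and
`isQuasiminimal_of_isExpAlgClosed` (`ℂ_exp`, Bays–Kirby Thm 1.5) rest on the same two named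
facts, Props 11.5 and 11.2 of Bays–Kirby 2018. Everything in this file is proved.

## References

* B. Zilber, *Pseudo-exponentiation on algebraically closed fields of characteristic zero*,
  Ann. Pure Appl. Logic 132 (2005) 67–95: Thm 1.2.
* M. Bays, J. Kirby, *Pseudo-exponential maps, variants, and quasiminimality*, Algebra & Number
  Theory 12 (2018) 493–549: Thm 1.2, Def. 5.14, Thm 6.9 (proof), Thm 9.1, Prop. 11.2,
  Prop. 11.5, Thm 11.6 (proof), Cor. 11.7.
* M. Bays, B. Hart, T. Hyttinen, M. Kesälä, J. Kirby, *Quasiminimal structures and excellence*,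
  Bull. LMS 46 (2014) 155–163: Prop. 7.1 (Karp).
-/

noncomputable section

open Set

universe u

namespace Literature.NumberTheory.Transcendental

namespace GammaField

open Literature.ModelTheory.ExponentialFields.ExponentialRing

variable {F : Type u} [Field F] [CharZero F] [Literature.ModelTheory.ExponentialFields.ExponentialRing F]

/-! ### One-point extensions from `ℵ₀`-saturation over `K` (the hull dichotomy) -/

/-- **Forth, from saturation over `K`** (universe-polymorphic form of
`GammaField.IsGammaIso.exists_extension`, with Bays–Kirby's saturation over `K` as a local
hypothesis and Γ-closedness of `ecl` of countable sets from the countable closure property).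
Let `F` be an uncountable exponential field with the countable closure property, `K` a countable
subspace, and suppose `F` is `ℵ₀`-saturated for Γ-algebraic strong extensions over `K`
(Bays–Kirby 2018, Def. 5.14, in the form of `BaysKirby2018_prop_11_2`: `hsat`). If `c ↦ c'` is a
Γ-isomorphism over `K` with `K + ℚc ◁ F`, `K + ℚc' ◁ F`, then for every `d` it extends to
`(c, e) ↦ (c', e')` with `e₀ = d` and both sides strong: minimise `δ(·/K + ℚc)` over
`K + ℚc + ℚd`; value `0` is a Γ-algebraic extension, embedded on the other side by `hsat`;
value `1` makes `d` generic with `K + ℚc + ℚd ◁ F`, matched by any `d'` outside the countable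
Γ-closed `ecl (K ∪ c')` (Lemma 4.13, `IsStrong.sup_span_singleton`; `IsGammaIso.snoc`).
[cite: BaysKirby2018ANT, Thm 11.6 (proof), Thm 6.9 (proof, QM4)] -/
theorem IsGammaIso.exists_extension_of_ccp [Uncountable F] (hccp : HasCountableClosureProperty F)
    {K : Submodule ℚ F} (hKc : (K : Set F).Countable)
    (hsat : ∀ {N k : ℕ} {c c' : Fin N → F} {e : Fin k → F},
      IsStrong (K ⊔ Submodule.span ℚ (range c)) → IsStrong (K ⊔ Submodule.span ℚ (range c')) →
      IsGammaIso K c c' →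
      predim (K ⊔ Submodule.span ℚ (range c)) (Submodule.span ℚ (range e)) = 0 →
      IsStrong (K ⊔ Submodule.span ℚ (range (Fin.append c e))) →
      ∃ e' : Fin k → F, IsGammaIso K (Fin.append c e) (Fin.append c' e') ∧
        IsStrong (K ⊔ Submodule.span ℚ (range (Fin.append c' e'))))
    {N : ℕ} {c c' : Fin N → F} (h : IsGammaIso K c c')
    (hs : IsStrong (K ⊔ Submodule.span ℚ (range c)))
    (hs' : IsStrong (K ⊔ Submodule.span ℚ (range c'))) (d : F) :
    ∃ (k : ℕ) (e e' : Fin (k + 1) → F), e 0 = d ∧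
      IsGammaIso K (Fin.append c e) (Fin.append c' e') ∧
      IsStrong (K ⊔ Submodule.span ℚ (range (Fin.append c e))) ∧
      IsStrong (K ⊔ Submodule.span ℚ (range (Fin.append c' e'))) := by
  classical
  set D := K ⊔ Submodule.span ℚ (range c) with hD
  set D' := K ⊔ Submodule.span ℚ (range c') with hD'
  have hfgd : IsFG D (D ⊔ Submodule.span ℚ {d}) :=
    isFG_sup_left.2 (isFG_span_of_finite D (finite_singleton d))
  obtain ⟨E, hDE, hfgE, -, hmin⟩ :=
    hs.exists_forall_predim_le (fun _ => True) le_sup_left hfgd trivial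
  have hEstrong : IsStrong E := isStrong_of_forall_predim_le (le_sup_left.trans hDE) hfgE
    fun X hX hfgX => hmin X (hDE.trans hX) hfgX trivial
  have h0 : 0 ≤ predim D E := hs (le_sup_left.trans hDE) hfgE
  have h1 : predim D E ≤ 1 := by
    have := hmin _ le_rfl hfgd trivial
    rw [predim_sup_left] at this
    exact this.trans (predim_span_singleton_le_one D d)
  rcases Int.le_iff_eq_or_lt.1 h1 with hm1 | hm0'
  · -- `δ = 1`: `d` is generic over `D`, and `D + ℚd ◁ F`
    have hd1 : predim D (Submodule.span ℚ {d}) = 1 := by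
      refine le_antisymm (predim_span_singleton_le_one D d) ?_
      have := hmin _ le_rfl hfgd trivial
      rw [predim_sup_left] at this
      omega
    have hdD : d ∉ D := by
      intro hdD
      rw [predim_eq_zero_of_le ((Submodule.span_singleton_le_iff_mem d D).2 hdD)] at hd1
      exact zero_ne_one hd1
    have hDd : IsStrong (D ⊔ Submodule.span ℚ {d}) :=
      isStrong_of_forall_predim_le le_sup_left hfgd fun X hX hfgX => by
        rw [predim_sup_left, hd1]
        have := hmin X hX hfgX trivial
        omega
    have htd : td D (Submodule.span ℚ {d}) = 2 := td_span_singleton_eq_two hdD hd1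
    -- the other side: a generic `d'` outside `ecl (K ∪ c')`
    set C₀ : Set F := (K : Set F) ∪ range c' with hC₀
    have hC₀c : C₀.Countable := hKc.union (countable_range c')
    obtain ⟨d', hd'⟩ : ∃ d', d' ∉ ecl C₀ := by
      by_contra! hall
      exact not_countable_univ ((hccp C₀ hC₀c).mono fun x _ => hall x)
    set H' := Submodule.span ℚ (ecl C₀) with hH'
    have hH'Γ : IsGammaClosed H' := isGammaClosed_span_ecl_of_countable hccp hC₀c
    have hD'H' : D' ≤ H' :=
      sup_le (fun x hx => subset_span_ecl C₀ (Or.inl hx))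
        (Submodule.span_le.2 fun x hx => subset_span_ecl C₀ (Or.inr hx))
    have hd'H : d' ∉ H' := by rwa [hH', mem_span_ecl_iff]
    obtain ⟨hD'd', hd'1⟩ := hs'.sup_span_singleton hH'Γ hD'H' hd'H
    have hd'D' : d' ∉ D' := fun h => hd'H (hD'H' h)
    have htd' : td D' (Submodule.span ℚ {d'}) = 2 := td_span_singleton_eq_two hd'D' hd'1
    have hiso : IsGammaIso K (Fin.snoc c d : Fin (N + 1) → F) (Fin.snoc c' d') := h.snoc htd htd'
    refine ⟨0, ![d], ![d'], rfl, ?_, ?_, ?_⟩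
    · rw [Fin.append_right_eq_snoc, Fin.append_right_eq_snoc]
      exact hiso
    · rw [Fin.append_right_eq_snoc, Matrix.cons_val_zero, sup_span_range_snoc]
      exact hDd
    · rw [Fin.append_right_eq_snoc, Matrix.cons_val_zero, sup_span_range_snoc]
      exact hD'd'
  · -- `δ = 0`: Γ-algebraic, embed by saturation
    have hm0 : predim D E = 0 := by omega
    obtain ⟨s, hsE, hEle⟩ := isFG_iff_exists_finset.1 hfgE
    let e : Fin (s.card + 1) → F := Fin.cons d fun i => ((s.equivFin.symm i : s) : F)
    have hrange : range e = insert d (s : Set F) := by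
      simp only [e, Fin.range_cons]
      congr 1
      ext x
      constructor
      · rintro ⟨i, rfl⟩; exact (s.equivFin.symm i).2
      · intro hx; exact ⟨s.equivFin ⟨x, hx⟩, by simp⟩
    have hdE : d ∈ E := hDE (Submodule.mem_sup_right (Submodule.mem_span_singleton_self d))
    have hE : D ⊔ Submodule.span ℚ (range e) = E := by
      refine le_antisymm (sup_le (le_sup_left.trans hDE) (Submodule.span_le.2 ?_)) ?_
      · rw [hrange]
        exact insert_subset hdE hsE
      · refine hEle.trans (sup_le_sup_left (Submodule.span_mono ?_) _)
        rw [hrange]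
        exact subset_insert _ _
    have happ : K ⊔ Submodule.span ℚ (range (Fin.append c e)) = E := by
      rw [sup_span_range_append, ← hD, hE]
    have hδ : predim D (Submodule.span ℚ (range e)) = 0 := by
      rw [← predim_sup_left, hE]; exact hm0
    obtain ⟨e', hiso, hstr⟩ := hsat hs hs' h hδ (by rw [happ]; exact hEstrong)
    exact ⟨s.card, e, e', by simp [e], hiso, by rw [happ]; exact hEstrong, hstr⟩

/-! ### The back-and-forth system, granted the one-point extension property -/

section Karp

open FirstOrder FirstOrder.Language

variable {K : Submodule ℚ F}
  (hext : ∀ {N : ℕ} {c c' : Fin N → F}, IsGammaIso K c c' →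
    IsStrong (K ⊔ Submodule.span ℚ (range c)) → IsStrong (K ⊔ Submodule.span ℚ (range c')) →
    ∀ d : F, ∃ (k : ℕ) (e e' : Fin (k + 1) → F), e 0 = d ∧
      IsGammaIso K (Fin.append c e) (Fin.append c' e') ∧
      IsStrong (K ⊔ Submodule.span ℚ (range (Fin.append c e))) ∧
      IsStrong (K ⊔ Submodule.span ℚ (range (Fin.append c' e'))))

include hext

/-- **Values of terms are captured by extensions** (universe-polymorphic form of
`exists_state_realize_term`, the one-point extension property `hext` being the hypothesis).
Given a state — a Γ-isomorphism `c ↦ c'` over `K` between tuples generating strong subspaces,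
whose coordinates cover the valuations `(v, xs)` and `(v', ys)` — and an `L_exp`-term `t`, there
is an extended state with a coordinate carrying `t(v, xs)` on the left and `t(v', ys)` on the
right (induction on `t`; the new coordinate on the right is forced by the linear / monomial /
exponential relation defining it, which transfers along the Γ-isomorphism at level `0`).
[cite: BaysKirby2018ANT, Thm 6.9 (proof)] -/
theorem exists_state_realize_term_of_extension {α : Type*} {n : ℕ}
    (t : Literature.ModelTheory.ExponentialFields.Language.expRing.Term (α ⊕ Fin n))
    {v v' : α → F} {xs ys : Fin n → F} {N : ℕ} {c c' : Fin N → F} (hiso : IsGammaIso K c c')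
    (hs : IsStrong (K ⊔ Submodule.span ℚ (range c)))
    (hs' : IsStrong (K ⊔ Submodule.span ℚ (range c')))
    (hv : ∀ i, ∃ j, c j = v i ∧ c' j = v' i) (hx : ∀ i, ∃ j, c j = xs i ∧ c' j = ys i) :
    ∃ (N₁ : ℕ) (c₁ c₁' : Fin N₁ → F), IsGammaIso K c₁ c₁' ∧
      IsStrong (K ⊔ Submodule.span ℚ (range c₁)) ∧ IsStrong (K ⊔ Submodule.span ℚ (range c₁')) ∧
      (∀ i, ∃ j, c₁ j = c i ∧ c₁' j = c' i) ∧
      ∃ j, c₁ j = t.realize (Sum.elim v xs) ∧ c₁' j = t.realize (Sum.elim v' ys) := by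
  classical
  -- one extension step by a prescribed element, keeping track of the old coordinates
  have step : ∀ {N : ℕ} {c c' : Fin N → F}, IsGammaIso K c c' →
      IsStrong (K ⊔ Submodule.span ℚ (range c)) → IsStrong (K ⊔ Submodule.span ℚ (range c')) →
      ∀ d : F, ∃ (N₁ : ℕ) (c₁ c₁' : Fin N₁ → F), IsGammaIso K c₁ c₁' ∧
        IsStrong (K ⊔ Submodule.span ℚ (range c₁)) ∧
        IsStrong (K ⊔ Submodule.span ℚ (range c₁')) ∧
        (∃ g : Fin N → Fin N₁, (∀ i, c₁ (g i) = c i) ∧ (∀ i, c₁' (g i) = c' i)) ∧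
        ∃ j, c₁ j = d := by
    intro N c c' hiso hs hs' d
    obtain ⟨k, e, e', he0, hiso₁, hs₁, hs₁'⟩ := hext hiso hs hs' d
    refine ⟨N + (k + 1), Fin.append c e, Fin.append c' e', hiso₁, hs₁, hs₁',
      ⟨Fin.castAdd (k + 1), fun i => Fin.append_left _ _ i, fun i => Fin.append_left _ _ i⟩,
      Fin.natAdd N 0, ?_⟩
    rw [Fin.append_right, he0]
  induction t generalizing N c c' with
  | var a =>
    refine ⟨N, c, c', hiso, hs, hs', fun i => ⟨i, rfl, rfl⟩, ?_⟩
    rcases a with i | i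
    · obtain ⟨j, hj, hj'⟩ := hv i
      exact ⟨j, by rw [Term.realize_var, Sum.elim_inl, hj],
        by rw [Term.realize_var, Sum.elim_inl, hj']⟩
    · obtain ⟨j, hj, hj'⟩ := hx i
      exact ⟨j, by rw [Term.realize_var, Sum.elim_inr, hj],
        by rw [Term.realize_var, Sum.elim_inr, hj']⟩
  | func f ts ih =>
    -- evaluate the arguments one after the other, threading the state
    have args : ∀ (m : ℕ) (hm : m ≤ _) , ∃ (N₁ : ℕ) (c₁ c₁' : Fin N₁ → F), IsGammaIso K c₁ c₁' ∧
        IsStrong (K ⊔ Submodule.span ℚ (range c₁)) ∧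
        IsStrong (K ⊔ Submodule.span ℚ (range c₁')) ∧
        (∀ i, ∃ j, c₁ j = c i ∧ c₁' j = c' i) ∧
        ∀ l (hl : l < m), ∃ j, c₁ j = (ts ⟨l, lt_of_lt_of_le hl hm⟩).realize (Sum.elim v xs) ∧
          c₁' j = (ts ⟨l, lt_of_lt_of_le hl hm⟩).realize (Sum.elim v' ys) := by
      intro m
      induction m with
      | zero =>
        intro _
        exact ⟨N, c, c', hiso, hs, hs', fun i => ⟨i, rfl, rfl⟩,
          fun l hl => (Nat.not_lt_zero l hl).elim⟩
      | succ m ihm =>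
        intro hm
        obtain ⟨N₁, c₁, c₁', hiso₁, hs₁, hs₁', hcov₁, hval₁⟩ := ihm (Nat.le_of_succ_le hm)
        have hv₁ : ∀ i, ∃ j, c₁ j = v i ∧ c₁' j = v' i := fun i => by
          obtain ⟨j, hj, hj'⟩ := hv i
          obtain ⟨j₁, h1, h1'⟩ := hcov₁ j
          exact ⟨j₁, h1.trans hj, h1'.trans hj'⟩
        have hx₁ : ∀ i, ∃ j, c₁ j = xs i ∧ c₁' j = ys i := fun i => by
          obtain ⟨j, hj, hj'⟩ := hx i
          obtain ⟨j₁, h1, h1'⟩ := hcov₁ j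
          exact ⟨j₁, h1.trans hj, h1'.trans hj'⟩
        obtain ⟨N₂, c₂, c₂', hiso₂, hs₂, hs₂', hcov₂, j₂, hj₂, hj₂'⟩ :=
          ih ⟨m, hm⟩ hiso₁ hs₁ hs₁' hv₁ hx₁
        refine ⟨N₂, c₂, c₂', hiso₂, hs₂, hs₂', fun i => ?_, fun l hl => ?_⟩
        · obtain ⟨j, hj, hj'⟩ := hcov₁ i
          obtain ⟨j', h1, h1'⟩ := hcov₂ j
          exact ⟨j', h1.trans hj, h1'.trans hj'⟩
        · rcases Nat.lt_succ_iff_lt_or_eq.1 hl with hl' | rfl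
          · obtain ⟨j, hj, hj'⟩ := hval₁ l hl'
            obtain ⟨j', h1, h1'⟩ := hcov₂ j
            exact ⟨j', h1.trans hj, h1'.trans hj'⟩
          · exact ⟨j₂, hj₂, hj₂'⟩
    obtain ⟨N₁, c₁, c₁', hiso₁, hs₁, hs₁', hcov₁, hval₁⟩ := args _ le_rfl
    -- the value of `func f ts`
    have hreal : ∀ (w : α ⊕ Fin n → F), (Term.func f ts).realize w =
        Structure.funMap f fun i => (ts i).realize w := fun w => rfl
    -- add the value on the left; the value on the right is then forced
    obtain ⟨N₂, c₂, c₂', hiso₂, hs₂, hs₂', ⟨g, hg, hg'⟩, j, hj⟩ :=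
      step hiso₁ hs₁ hs₁' ((Term.func f ts).realize (Sum.elim v xs))
    refine ⟨N₂, c₂, c₂', hiso₂, hs₂, hs₂', fun i => ?_, j, hj, ?_⟩
    · obtain ⟨j₁, h1, h1'⟩ := hcov₁ i
      exact ⟨g j₁, (hg j₁).trans h1, (hg' j₁).trans h1'⟩
    -- indices of the arguments in the final state
    have hargs : ∀ i : Fin _, ∃ j', c₂ j' = (ts i).realize (Sum.elim v xs) ∧
        c₂' j' = (ts i).realize (Sum.elim v' ys) := fun i => by
      obtain ⟨j₁, h1, h1'⟩ := hval₁ i.1 i.2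
      exact ⟨g j₁, (hg j₁).trans h1, (hg' j₁).trans h1'⟩
    -- transfer the defining relation along the Γ-isomorphism (level `0`)
    have transfer : ∀ P : MvPolynomial (Fin N₂ ⊕ Fin N₂) (fieldOf K),
        MvPolynomial.aeval (lvGens 0 c₂) P = 0 → MvPolynomial.aeval (lvGens 0 c₂') P = 0 :=
      fun P => (hiso₂.aeval_eq_zero_iff 0 P).1
    cases f with
    | add =>
      obtain ⟨j₀, h0, h0'⟩ := hargs 0
      obtain ⟨j₁, h1, h1'⟩ := hargs 1
      have := transfer (MvPolynomial.X (Sum.inl j) - (MvPolynomial.X (Sum.inl j₀) +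
        MvPolynomial.X (Sum.inl j₁))) (by simp [hj, hreal, h0, h1])
      simp only [map_sub, map_add, MvPolynomial.aeval_X, lvGens_inl, sub_eq_zero] at this
      rw [this, hreal, Literature.ModelTheory.ExponentialFields.Language.expRing.funMap_add, h0', h1']
    | mul =>
      obtain ⟨j₀, h0, h0'⟩ := hargs 0
      obtain ⟨j₁, h1, h1'⟩ := hargs 1
      have := transfer (MvPolynomial.X (Sum.inl j) - (MvPolynomial.X (Sum.inl j₀) *
        MvPolynomial.X (Sum.inl j₁))) (by simp [hj, hreal, h0, h1])
      simp only [map_sub, map_mul, MvPolynomial.aeval_X, lvGens_inl, sub_eq_zero] at this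
      rw [this, hreal, Literature.ModelTheory.ExponentialFields.Language.expRing.funMap_mul, h0', h1']
    | neg =>
      obtain ⟨j₀, h0, h0'⟩ := hargs 0
      have := transfer (MvPolynomial.X (Sum.inl j) + MvPolynomial.X (Sum.inl j₀))
        (by simp [hj, hreal, h0])
      simp only [map_add, MvPolynomial.aeval_X, lvGens_inl, add_eq_zero_iff_eq_neg] at this
      rw [this, hreal, Literature.ModelTheory.ExponentialFields.Language.expRing.funMap_neg, h0']
    | zero =>
      have := transfer (MvPolynomial.X (Sum.inl j)) (by simp [hj, hreal])
      simp only [MvPolynomial.aeval_X, lvGens_inl] at this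
      rw [this, hreal, Literature.ModelTheory.ExponentialFields.Language.expRing.funMap_zero]
    | one =>
      have := transfer (MvPolynomial.X (Sum.inl j) - 1) (by simp [hj, hreal])
      simp only [map_sub, map_one, MvPolynomial.aeval_X, lvGens_inl, sub_eq_zero] at this
      rw [this, hreal, Literature.ModelTheory.ExponentialFields.Language.expRing.funMap_one]
    | exp =>
      obtain ⟨j₀, h0, h0'⟩ := hargs 0
      have := transfer (MvPolynomial.X (Sum.inl j) - MvPolynomial.X (Sum.inr j₀))
        (by simp [hj, hreal, h0])
      simp only [map_sub, MvPolynomial.aeval_X, lvGens_inl, lvGens_zero_inr, sub_eq_zero] at this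
      rw [this, hreal, Literature.ModelTheory.ExponentialFields.Language.expRing.funMap_exp, h0']

/-- **The Γ-isomorphisms over `K` between strong finitely generated subspaces form a
back-and-forth system** for `L_exp = ⟨+, ·, -, 0, 1, exp⟩`, granted the one-point extension
property `hext` (universe-polymorphic form of `isBackAndForth_gammaIso`): related tuples satisfy
the same atomic formulas (`exists_state_realize_term_of_extension` and transfer of equalities),
and every element can be added on either side (`hext` and symmetry).
[cite: BaysKirby2018ANT, Thm 6.9 (proof)] -/
theorem isBackAndForth_gammaIso_of_extension {α : Type*} (v v' : α → F) :
    Literature.ModelTheory.ExponentialFields.Language.expRing.IsBackAndForth v v' fun n (xs ys : Fin n → F) =>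
      ∃ (N : ℕ) (c c' : Fin N → F), IsGammaIso K c c' ∧
        IsStrong (K ⊔ Submodule.span ℚ (range c)) ∧ IsStrong (K ⊔ Submodule.span ℚ (range c')) ∧
        (∀ i, ∃ j, c j = v i ∧ c' j = v' i) ∧ (∀ i, ∃ j, c j = xs i ∧ c' j = ys i) := by
  classical
  refine ⟨?_, ?_, ?_⟩
  · -- atomic formulas
    rintro n xs ys ⟨N, c, c', hiso, hs, hs', hv, hx⟩ φ hφ
    cases hφ with
    | equal t₁ t₂ =>
      obtain ⟨N₁, c₁, c₁', hiso₁, hs₁, hs₁', hcov₁, j₁, hj₁, hj₁'⟩ :=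
        exists_state_realize_term_of_extension hext t₁ hiso hs hs' hv hx
      have hv₁ : ∀ i, ∃ j, c₁ j = v i ∧ c₁' j = v' i := fun i => by
        obtain ⟨j, hj, hj'⟩ := hv i
        obtain ⟨j', h1, h1'⟩ := hcov₁ j
        exact ⟨j', h1.trans hj, h1'.trans hj'⟩
      have hx₁ : ∀ i, ∃ j, c₁ j = xs i ∧ c₁' j = ys i := fun i => by
        obtain ⟨j, hj, hj'⟩ := hx i
        obtain ⟨j', h1, h1'⟩ := hcov₁ j
        exact ⟨j', h1.trans hj, h1'.trans hj'⟩
      obtain ⟨N₂, c₂, c₂', hiso₂, hs₂, hs₂', hcov₂, j₂, hj₂, hj₂'⟩ :=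
        exists_state_realize_term_of_extension hext t₂ hiso₁ hs₁ hs₁' hv₁ hx₁
      obtain ⟨j₁', h1, h1'⟩ := hcov₂ j₁
      rw [BoundedFormula.realize_bdEqual, BoundedFormula.realize_bdEqual, ← hj₁, ← hj₁', ← h1,
        ← h1',
        ← hj₂, ← hj₂']
      exact hiso₂.apply_eq_iff j₁' j₂
    | rel R ts => exact (show Empty from R).elim
  · -- forth
    rintro n xs ys ⟨N, c, c', hiso, hs, hs', hv, hx⟩ a
    obtain ⟨k, e, e', he0, hiso₁, hs₁, hs₁'⟩ := hext hiso hs hs' a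
    refine ⟨e' 0, N + (k + 1), Fin.append c e, Fin.append c' e', hiso₁, hs₁, hs₁', fun i => ?_,
      fun i => ?_⟩
    · obtain ⟨j, hj, hj'⟩ := hv i
      exact ⟨Fin.castAdd (k + 1) j, by rw [Fin.append_left, hj], by rw [Fin.append_left, hj']⟩
    · refine Fin.lastCases ?_ (fun i => ?_) i
      · refine ⟨Fin.natAdd N 0, ?_, ?_⟩
        · rw [Fin.append_right, he0, Fin.snoc_last]
        · rw [Fin.append_right, Fin.snoc_last]
      · obtain ⟨j, hj, hj'⟩ := hx i
        exact ⟨Fin.castAdd (k + 1) j, by rw [Fin.append_left, hj, Fin.snoc_castSucc],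
          by rw [Fin.append_left, hj', Fin.snoc_castSucc]⟩
  · -- back (by symmetry)
    rintro n xs ys ⟨N, c, c', hiso, hs, hs', hv, hx⟩ b
    obtain ⟨k, e, e', he0, hiso₁, hs₁, hs₁'⟩ := hext hiso.symm hs' hs b
    refine ⟨e' 0, N + (k + 1), Fin.append c e', Fin.append c' e, hiso₁.symm, hs₁', hs₁, fun i => ?_,
      fun i => ?_⟩
    · obtain ⟨j, hj, hj'⟩ := hv i
      exact ⟨Fin.castAdd (k + 1) j, by rw [Fin.append_left, hj], by rw [Fin.append_left, hj']⟩
    · refine Fin.lastCases ?_ (fun i => ?_) i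
      · refine ⟨Fin.natAdd N 0, ?_, ?_⟩
        · rw [Fin.append_right, Fin.snoc_last]
        · rw [Fin.append_right, he0, Fin.snoc_last]
      · obtain ⟨j, hj, hj'⟩ := hx i
        exact ⟨Fin.castAdd (k + 1) j, by rw [Fin.append_left, hj, Fin.snoc_castSucc],
          by rw [Fin.append_left, hj', Fin.snoc_castSucc]⟩

end Karp

/-! ### Quasiminimality from the extension property over `ecl ∅` -/

open FirstOrder FirstOrder.Language in
/-- **Bays–Kirby 2018, Thm 11.6 with `K = ecl ∅`, from the one-point extension property**
(universe-polymorphic core of `isQuasiminimal_of_isExpAlgClosed_of_ccp_of_facts`). Let `F` be an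
uncountable exponential field of characteristic zero with the countable closure property in which
the Γ-isomorphisms over `K = ecl ∅` between tuples generating strong subspaces have the one-point
extension property (`hext`). Then `F` is quasiminimal: a definable set `S = φ(F, b)` has finitely
many parameters `b`; `H = ecl b` is countable (CCP) and Γ-closed (Kirby 2010 Thm 1.2, here in all
universes by `isGammaClosed_span_ecl_of_countable`), and so is `K`; for `a, a' ∉ H`, the hull
`D₀` of `K + ℚb` inside `H` is strong and `(D₀, a) ↦ (D₀, a')` is a Γ-isomorphism over `K`
between strong subspaces (Lemma 4.13, `IsGammaIso.snoc`), i.e. a state of the back-and-forth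
system `isBackAndForth_gammaIso_of_extension`; by Karp's lemma `a ∈ S ↔ a' ∈ S`. Hence `S ⊆ H`
or `F ∖ S ⊆ H`. [cite: BaysKirby2018ANT, Thm 11.6 (proof), Cor. 11.7] -/
theorem isQuasiminimal_of_ccp_of_extension [Uncountable F] (hccp : HasCountableClosureProperty F)
    (hext : ∀ {N : ℕ} {c c' : Fin N → F}, IsGammaIso (Submodule.span ℚ (ecl (∅ : Set F))) c c' →
      IsStrong (Submodule.span ℚ (ecl (∅ : Set F)) ⊔ Submodule.span ℚ (range c)) →
      IsStrong (Submodule.span ℚ (ecl (∅ : Set F)) ⊔ Submodule.span ℚ (range c')) →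
      ∀ d : F, ∃ (k : ℕ) (e e' : Fin (k + 1) → F), e 0 = d ∧
        IsGammaIso (Submodule.span ℚ (ecl (∅ : Set F))) (Fin.append c e) (Fin.append c' e') ∧
        IsStrong (Submodule.span ℚ (ecl (∅ : Set F)) ⊔ Submodule.span ℚ (range (Fin.append c e))) ∧
        IsStrong (Submodule.span ℚ (ecl (∅ : Set F)) ⊔
          Submodule.span ℚ (range (Fin.append c' e')))) :
    Literature.ModelTheory.ExponentialFields.Language.expRing.IsQuasiminimal F := by
  classical
  intro S hS
  -- finitely many parameters and a defining formula
  obtain ⟨A₀, -, hA₀⟩ := Set.definable_iff_finitely_definable.1 hS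
  obtain ⟨φ, hφ⟩ := Set.definable_iff_exists_formula_sum.1 hA₀
  set k := Fintype.card (A₀ : Set F) with hk
  let eA : (A₀ : Set F) ≃ Fin k := Fintype.equivFin _
  let b : Fin k → F := fun i => (eA.symm i : F)
  have hmem : ∀ a : F, a ∈ S ↔ φ.Realize (Sum.elim ((↑) : ↥(A₀ : Set F) → F) ![a]) := by
    intro a
    have := Set.ext_iff.1 hφ ![a]
    simpa only [Set.mem_setOf_eq, Matrix.cons_val_fin_one] using this
  let g : (A₀ : Set F) ⊕ Fin 1 → Fin (k + 1) := Sum.elim (Fin.castSucc ∘ eA) fun _ => Fin.last k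
  have hg : ∀ a : F, (Fin.snoc b a : Fin (k + 1) → F) ∘ g =
      Sum.elim ((↑) : ↥(A₀ : Set F) → F) ![a] := by
    intro a
    funext x
    rcases x with x | x
    · simp [g, b]
    · simp [g]
  have hmem' : ∀ a : F, a ∈ S ↔ (φ.relabel g).Realize (Fin.snoc b a : Fin (k + 1) → F) := by
    intro a
    rw [hmem, Formula.realize_relabel, hg]
  -- the base `K = ecl ∅` and the closed set `H = ecl b`
  set K : Submodule ℚ F := Submodule.span ℚ (ecl (∅ : Set F)) with hK
  have hKΓ : IsGammaClosed K := isGammaClosed_span_ecl_of_countable hccp countable_empty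
  set H : Submodule ℚ F := Submodule.span ℚ (ecl (range b)) with hH
  have hHΓ : IsGammaClosed H := isGammaClosed_span_ecl_of_countable hccp (countable_range b)
  have hHc : (ecl (range b)).Countable := hccp _ (countable_range b)
  have hKH : K ≤ H := span_ecl_mono (empty_subset _)
  have hΛ₁H : K ⊔ Submodule.span ℚ (range b) ≤ H := sup_le hKH (span_le_span_ecl _)
  have hfg₁ : IsFG K (K ⊔ Submodule.span ℚ (range b)) :=
    isFG_sup_left.2 (isFG_span_of_finite K (finite_range b))
  obtain ⟨D₀, hΛ₁D₀, hD₀H, hfgD₀, hD₀⟩ :=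
    hKΓ.isStrong.exists_isStrong_of_le hHΓ.isStrong le_sup_left hΛ₁H hfg₁
  obtain ⟨s, hsD₀, hD₀le⟩ := isFG_iff_exists_finset.1 hfgD₀
  let c₀ : Fin (s.card + k) → F := Fin.append (fun i => ((s.equivFin.symm i : s) : F)) b
  have hsrange : range (fun i : Fin s.card => ((s.equivFin.symm i : s) : F)) = (s : Set F) := by
    ext x
    constructor
    · rintro ⟨i, rfl⟩; exact (s.equivFin.symm i).2
    · intro hx; exact ⟨s.equivFin ⟨x, hx⟩, by simp⟩
  have hc₀ : K ⊔ Submodule.span ℚ (range c₀) = D₀ := by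
    have hr : range c₀ = (s : Set F) ∪ range b := by
      show range (Fin.append _ _) = _
      rw [ZilberHomogeneity.range_append, hsrange]
    rw [hr]
    refine le_antisymm (sup_le (le_sup_left.trans hΛ₁D₀)
      (Submodule.span_le.2 (union_subset hsD₀ ?_))) ?_
    · exact fun x hx => hΛ₁D₀ (Submodule.mem_sup_right (Submodule.subset_span hx))
    · exact hD₀le.trans (sup_le_sup_left (Submodule.span_mono subset_union_left) _)
  -- all points outside `H` behave alike
  have hgen : ∀ ⦃a a' : F⦄, a ∉ ecl (range b) → a' ∉ ecl (range b) → (a ∈ S ↔ a' ∈ S) := by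
    intro a a' ha ha'
    have haH : a ∉ H := by rwa [hH, mem_span_ecl_iff]
    have ha'H : a' ∉ H := by rwa [hH, mem_span_ecl_iff]
    obtain ⟨hDa, ha1⟩ := hD₀.sup_span_singleton hHΓ hD₀H haH
    obtain ⟨hDa', ha'1⟩ := hD₀.sup_span_singleton hHΓ hD₀H ha'H
    have haD : a ∉ D₀ := fun h => haH (hD₀H h)
    have ha'D : a' ∉ D₀ := fun h => ha'H (hD₀H h)
    have htda : td (K ⊔ Submodule.span ℚ (range c₀)) (Submodule.span ℚ {a}) = 2 := by
      rw [hc₀]; exact td_span_singleton_eq_two haD ha1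
    have htda' : td (K ⊔ Submodule.span ℚ (range c₀)) (Submodule.span ℚ {a'}) = 2 := by
      rw [hc₀]; exact td_span_singleton_eq_two ha'D ha'1
    have hstart : IsGammaIso K (Fin.snoc c₀ a : Fin (s.card + k + 1) → F) (Fin.snoc c₀ a') :=
      (IsGammaIso.refl K c₀).snoc htda htda'
    have hsa :
        IsStrong (K ⊔ Submodule.span ℚ (range (Fin.snoc c₀ a : Fin (s.card + k + 1) → F))) := by
      rw [sup_span_range_snoc, hc₀]; exact hDa
    have hsa' :
        IsStrong (K ⊔ Submodule.span ℚ (range (Fin.snoc c₀ a' : Fin (s.card + k + 1) → F))) := by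
      rw [sup_span_range_snoc, hc₀]; exact hDa'
    have hBF := isBackAndForth_gammaIso_of_extension hext
      (Fin.snoc b a : Fin (k + 1) → F) (Fin.snoc b a')
    have hcov : ∀ i : Fin (k + 1), ∃ j,
        (Fin.snoc c₀ a : Fin (s.card + k + 1) → F) j = (Fin.snoc b a : Fin (k + 1) → F) i ∧
        (Fin.snoc c₀ a' : Fin (s.card + k + 1) → F) j = (Fin.snoc b a' : Fin (k + 1) → F) i := by
      intro i
      refine Fin.lastCases ?_ (fun i => ?_) i
      · exact ⟨Fin.last _, by simp only [Fin.snoc_last], by simp only [Fin.snoc_last]⟩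
      · refine ⟨Fin.castSucc (Fin.natAdd s.card i), ?_, ?_⟩
        · rw [Fin.snoc_castSucc, Fin.snoc_castSucc]; exact Fin.append_right _ _ i
        · rw [Fin.snoc_castSucc, Fin.snoc_castSucc]; exact Fin.append_right _ _ i
    have key := realize_iff_of_isBackAndForth hBF (φ.relabel g) (xs := default) (ys := default)
      ⟨_, Fin.snoc c₀ a, Fin.snoc c₀ a', hstart, hsa, hsa', hcov, fun i => i.elim0⟩
    rw [hmem' a, hmem' a']
    exact key
  by_cases hex : ∃ a ∈ S, a ∉ ecl (range b)
  · obtain ⟨a, haS, haH⟩ := hex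
    refine Or.inr (hHc.mono fun x hx => ?_)
    by_contra hxH
    exact hx ((hgen haH hxH).1 haS)
  · refine Or.inl (hHc.mono fun a ha => ?_)
    by_contra haH
    exact hex ⟨a, ha, haH⟩

/-- **Quasiminimality from `ℵ₀`-saturation over `ecl ∅`** (any universe): an exponential field of
characteristic zero with the countable closure property which — if uncountable — is
`ℵ₀`-saturated for Γ-algebraic strong extensions over the countable subspace `ecl ∅` (Bays–Kirby
2018, Def. 5.14, in the form of `BaysKirby2018_prop_11_2`) is quasiminimal: countable fields
trivially, uncountable ones by `isQuasiminimal_of_ccp_of_extension` and the hull dichotomy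
`IsGammaIso.exists_extension_of_ccp`. [cite: BaysKirby2018ANT, Thm 11.6 (proof)] -/
theorem isQuasiminimal_of_ccp_of_saturatedOver (hccp : HasCountableClosureProperty F)
    (hsat : ∀ [Uncountable F] {N k : ℕ} {c c' : Fin N → F} {e : Fin k → F},
      IsStrong (Submodule.span ℚ (ecl (∅ : Set F)) ⊔ Submodule.span ℚ (range c)) →
      IsStrong (Submodule.span ℚ (ecl (∅ : Set F)) ⊔ Submodule.span ℚ (range c')) →
      IsGammaIso (Submodule.span ℚ (ecl (∅ : Set F))) c c' →
      predim (Submodule.span ℚ (ecl (∅ : Set F)) ⊔ Submodule.span ℚ (range c))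
        (Submodule.span ℚ (range e)) = 0 →
      IsStrong (Submodule.span ℚ (ecl (∅ : Set F)) ⊔ Submodule.span ℚ (range (Fin.append c e))) →
      ∃ e' : Fin k → F, IsGammaIso (Submodule.span ℚ (ecl (∅ : Set F))) (Fin.append c e)
          (Fin.append c' e') ∧
        IsStrong (Submodule.span ℚ (ecl (∅ : Set F)) ⊔
          Submodule.span ℚ (range (Fin.append c' e')))) :
    Literature.ModelTheory.ExponentialFields.Language.expRing.IsQuasiminimal F := by
  by_cases hcount : Countable F
  · exact fun S _ => Or.inl S.to_countable
  haveI : Uncountable F := not_countable_iff.1 hcount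
  have hKc : ((Submodule.span ℚ (ecl (∅ : Set F)) : Submodule ℚ F) : Set F).Countable :=
    countable_span_ecl hccp countable_empty
  exact isQuasiminimal_of_ccp_of_extension hccp fun hiso hs hs' d =>
    hiso.exists_extension_of_ccp hccp hKc (fun hs₁ hs₁' h₁ hδ hstr => hsat hs₁ hs₁' h₁ hδ hstr)
      hs hs' d

end GammaField

/-! ### Cor. 11.7 (exponential case) in every universe -/

section Cor117

open GammaField Literature.ModelTheory.ExponentialFields.ExponentialRing

/-- **Bays–Kirby 2018, Cor. 11.7 in the exponential case, in every universe, from the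
saturation fact** (`BaysKirby2018_saturation_of_isExpAlgClosed`, Props 11.5 + 11.2): a full
exponential field with the countable closure property which is exponentially-algebraically closed
is quasiminimal. (The `Type`-restricted version is
`BaysKirby2018_isQuasiminimal_of_isExpAlgClosed_of_ccp_of_saturation`; here Γ-closedness of
`ecl C`, `C` countable, comes from the countable closure property instead of Ax's theorem.)
[cite: BaysKirby2018ANT, Cor. 11.7] -/
theorem BaysKirby2018_isQuasiminimal_of_isExpAlgClosed_of_ccp_of_saturation_univ
    (hSAT : BaysKirby2018_saturation_of_isExpAlgClosed.{u}) :
    BaysKirby2018_isQuasiminimal_of_isExpAlgClosed_of_ccp.{u} := by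
  intro F _ _ _ hF hsurj hccp hEAC
  refine isQuasiminimal_of_ccp_of_saturatedOver hccp fun hs hs' h hδ hstr => ?_
  have hKc : ((Submodule.span ℚ (ecl (∅ : Set F)) : Submodule ℚ F) : Set F).Countable :=
    countable_span_ecl hccp countable_empty
  have hKΓ : IsGammaClosed (Submodule.span ℚ (ecl (∅ : Set F))) :=
    isGammaClosed_span_ecl_of_countable hccp countable_empty
  have hKtop : (Submodule.span ℚ (ecl (∅ : Set F)) : Submodule ℚ F) ≠ ⊤ := by
    intro htop
    apply not_countable_univ (α := F)
    have : ((⊤ : Submodule ℚ F) : Set F) = univ := rfl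
    rw [← this, ← htop]
    exact hKc
  exact hSAT hF hsurj hEAC hKΓ hKtop hKc hs hs' h hδ hstr

/-- **Bays–Kirby 2018, Cor. 11.7 in the exponential case, in every universe, from Props 11.5 and
11.2** (the Zariski-density form of Γ-closedness, Def. 10.3, being proved:
`BaysKirby2018_gammaPoints_dense_of_isExpAlgClosed_holds`). [cite: BaysKirby2018ANT, Cor. 11.7, Prop. 11.5, Prop. 11.2] -/
theorem BaysKirby2018_isQuasiminimal_of_isExpAlgClosed_of_ccp_of_props_univ
    (h5 : BaysKirby2018_prop_11_5.{u}) (h2 : BaysKirby2018_prop_11_2.{u}) :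
    BaysKirby2018_isQuasiminimal_of_isExpAlgClosed_of_ccp.{u} :=
  BaysKirby2018_isQuasiminimal_of_isExpAlgClosed_of_ccp_of_saturation_univ
    (BaysKirby2018_saturation_of_isExpAlgClosed_of_facts
      BaysKirby2018_gammaPoints_dense_of_isExpAlgClosed_holds h5 h2)

end Cor117

/-! ### Zilber fields -/

section ZilberFields

open GammaField Literature.ModelTheory.ExponentialFields.ExponentialRing

/-- **A Zilber field is quasiminimal, granted Bays–Kirby's Cor. 11.7** (exponential case): a
Zilber field is algebraically closed with `exp` onto `Fˣ` (a full Γ-field), has the countable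
closure property, and is exponentially-algebraically closed since it is strongly so
(`IsStronglyExpAlgClosed.isExpAlgClosed`). This is how Bays–Kirby 2018 Thm 1.2 (= Zilber 2005
Thm 1.2, quasiminimality half) sits inside Thm 1.7 / Thm 11.6. [cite: BaysKirby2018ANT, Thm 1.2, Cor. 11.7]
[cite: Zilber2005PseudoExp, Thm 1.2] -/
theorem IsZilberField.isQuasiminimal_of_cor_11_7
    (h : BaysKirby2018_isQuasiminimal_of_isExpAlgClosed_of_ccp.{u}) :
    IsZilberField.isQuasiminimal.{u} :=
  fun hK => h hK.isAlgClosed hK.isSurjectiveOntoUnits hK.hasCountableClosureProperty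
    hK.isStronglyExpAlgClosed.isExpAlgClosed

/-- **A Zilber field is quasiminimal, granted Bays–Kirby's saturation fact**
(`BaysKirby2018_saturation_of_isExpAlgClosed`, Props 11.5 + 11.2 over a countable Γ-closed base),
in every universe. [cite: BaysKirby2018ANT, Thm 1.2, Thm 11.6] [cite: Zilber2005PseudoExp, Thm 1.2] -/
theorem IsZilberField.isQuasiminimal_of_saturation_of_isExpAlgClosed
    (hSAT : BaysKirby2018_saturation_of_isExpAlgClosed.{u}) :
    IsZilberField.isQuasiminimal.{u} :=
  IsZilberField.isQuasiminimal_of_cor_11_7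
    (BaysKirby2018_isQuasiminimal_of_isExpAlgClosed_of_ccp_of_saturation_univ hSAT)

/-- **Reduction of Zilber 2005 Thm 1.2 (quasiminimality of Zilber fields) to Bays–Kirby 2018,
Props 11.5 and 11.2**, in every universe: the same two named facts on which the tree's proof
of Bays–Kirby's Thm 1.5 (`isQuasiminimal_of_isExpAlgClosed_of_props`) rests.
[cite: Zilber2005PseudoExp, Thm 1.2] [cite: BaysKirby2018ANT, Thm 1.2, Prop. 11.5, Prop. 11.2] -/
theorem IsZilberField.isQuasiminimal_of_props
    (h5 : BaysKirby2018_prop_11_5.{u}) (h2 : BaysKirby2018_prop_11_2.{u}) :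
    IsZilberField.isQuasiminimal.{u} :=
  IsZilberField.isQuasiminimal_of_cor_11_7
    (BaysKirby2018_isQuasiminimal_of_isExpAlgClosed_of_ccp_of_props_univ h5 h2)

/-- **Zilber fields are quasiminimal as soon as each uncountable Zilber field is `ℵ₀`-saturated
for Γ-algebraic strong extensions over `ecl ∅`** (Bays–Kirby 2018, Def. 5.14 with base
`K = ecl ∅`, which is countable and Γ-closed; the models of `ECF_{SK,CCP}` are so saturated by
Thm 11.6 / Lemma 8.3). This isolates, for the target fact `IsZilberField.isQuasiminimal`, the
one remaining input in hypothesis-local form (no appeal to exponential-algebraic closedness of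
other fields). [cite: BaysKirby2018ANT, Thm 11.6 (proof), Def. 5.14] -/
theorem IsZilberField.isQuasiminimal_of_saturatedOver
    (hsat : ∀ {F : Type u} [Field F] [CharZero F] [Literature.ModelTheory.ExponentialFields.ExponentialRing F]
      [Uncountable F], IsZilberField F →
      ∀ {N k : ℕ} {c c' : Fin N → F} {e : Fin k → F},
      IsStrong (Submodule.span ℚ (ecl (∅ : Set F)) ⊔ Submodule.span ℚ (range c)) →
      IsStrong (Submodule.span ℚ (ecl (∅ : Set F)) ⊔ Submodule.span ℚ (range c')) →
      IsGammaIso (Submodule.span ℚ (ecl (∅ : Set F))) c c' →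
      predim (Submodule.span ℚ (ecl (∅ : Set F)) ⊔ Submodule.span ℚ (range c))
        (Submodule.span ℚ (range e)) = 0 →
      IsStrong (Submodule.span ℚ (ecl (∅ : Set F)) ⊔ Submodule.span ℚ (range (Fin.append c e))) →
      ∃ e' : Fin k → F, IsGammaIso (Submodule.span ℚ (ecl (∅ : Set F))) (Fin.append c e)
          (Fin.append c' e') ∧
        IsStrong (Submodule.span ℚ (ecl (∅ : Set F)) ⊔
          Submodule.span ℚ (range (Fin.append c' e')))) :
    IsZilberField.isQuasiminimal.{u} :=
  fun hK => isQuasiminimal_of_ccp_of_saturatedOver hK.hasCountableClosureProperty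
    fun hs hs' h hδ hstr => hsat hK hs hs' h hδ hstr

/-- **Zilber fields are quasiminimal as soon as, in each uncountable Zilber field, the
Γ-isomorphisms over `ecl ∅` between tuples generating strong subspaces have the one-point
extension property** (the back-and-forth condition of Bays–Kirby 2018, proof of Thm 6.9 /
Thm 11.6; Zilber 2005 §5). [cite: BaysKirby2018ANT, Thm 6.9 (proof), Thm 11.6 (proof)]
[cite: Zilber2005PseudoExp, §5 and Thm 1.2] -/
theorem IsZilberField.isQuasiminimal_of_extension
    (hext : ∀ {F : Type u} [Field F] [CharZero F] [Literature.ModelTheory.ExponentialFields.ExponentialRing F]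
      [Uncountable F], IsZilberField F →
      ∀ {N : ℕ} {c c' : Fin N → F}, IsGammaIso (Submodule.span ℚ (ecl (∅ : Set F))) c c' →
      IsStrong (Submodule.span ℚ (ecl (∅ : Set F)) ⊔ Submodule.span ℚ (range c)) →
      IsStrong (Submodule.span ℚ (ecl (∅ : Set F)) ⊔ Submodule.span ℚ (range c')) →
      ∀ d : F, ∃ (k : ℕ) (e e' : Fin (k + 1) → F), e 0 = d ∧
        IsGammaIso (Submodule.span ℚ (ecl (∅ : Set F))) (Fin.append c e) (Fin.append c' e') ∧
        IsStrong (Submodule.span ℚ (ecl (∅ : Set F)) ⊔ Submodule.span ℚ (range (Fin.append c e))) ∧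
        IsStrong (Submodule.span ℚ (ecl (∅ : Set F)) ⊔
          Submodule.span ℚ (range (Fin.append c' e')))) :
    IsZilberField.isQuasiminimal.{u} := by
  intro F _ _ _ hK S hS
  by_cases hcount : Countable F
  · exact Or.inl S.to_countable
  haveI : Uncountable F := not_countable_iff.1 hcount
  exact isQuasiminimal_of_ccp_of_extension hK.hasCountableClosureProperty
    (fun hiso hs hs' d => hext hK hiso hs hs' d) S hS

end ZilberFields

/-! ### The route through generic strong Γ-closedness over `ecl ∅` (no weak Zilber–Pink input named) -/

section GenericStrongClosedness

open GammaField Literature.ModelTheory.ExponentialFields.ExponentialRing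

/-- **Quasiminimality of Zilber fields from Bays–Kirby's Prop. 11.2 and generic strong
Γ-closedness over `ecl ∅`.** If every uncountable Zilber field `F` is generically strongly
Γ-closed over `K = ecl ∅` (Bays–Kirby 2018, Def. 11.1: `GammaField.IsGenericallyStronglyGammaClosedOver`),
then, granted Prop. 11.2 (GSΓC over `K` ⟹ `ℵ₀`-saturation for Γ-algebraic extensions over `K`,
`BaysKirby2018_prop_11_2`), every Zilber field is quasiminimal (`IsZilberField.isQuasiminimal_of_saturatedOver`;
`K = ecl ∅` is countable by the countable closure property, Γ-closed by Kirby's Thm 1.2, and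
`≠ F` for `F` uncountable). For Zilber fields the hypothesis follows from Prop. 11.5
(`IsZilberField.isGenericallyStronglyGammaClosedOver_of_prop_11_5`); this form isolates it so that a
direct proof from *strong* exponential-algebraic closedness — the argument of Prop. 11.5 with the
minimal subgroup `J` in place of the subgroup `H` supplied there by the weak Zilber–Pink theorem,
genericity over finitely generated fields replacing Zariski density — can be plugged in.
[cite: BaysKirby2018ANT, Prop. 11.2, Def. 11.1, Thm 11.6 (proof)] -/
theorem IsZilberField.isQuasiminimal_of_prop_11_2 (h2 : BaysKirby2018_prop_11_2.{u})
    (hG : ∀ {F : Type u} [Field F] [CharZero F] [Literature.ModelTheory.ExponentialFields.ExponentialRing F]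
      [Uncountable F], IsZilberField F →
      IsGenericallyStronglyGammaClosedOver (Submodule.span ℚ (ecl (∅ : Set F)))) :
    IsZilberField.isQuasiminimal.{u} := by
  refine IsZilberField.isQuasiminimal_of_saturatedOver fun {F} _ _ _ _ hK {N k c c' e} hs hs' h hδ _ => ?_
  have hKc : ((Submodule.span ℚ (ecl (∅ : Set F)) : Submodule ℚ F) : Set F).Countable :=
    countable_span_ecl hK.hasCountableClosureProperty countable_empty
  have hKΓ : IsGammaClosed (Submodule.span ℚ (ecl (∅ : Set F))) :=
    isGammaClosed_span_ecl_of_countable hK.hasCountableClosureProperty countable_empty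
  have hKtop : (Submodule.span ℚ (ecl (∅ : Set F)) : Submodule ℚ F) ≠ ⊤ := by
    intro htop
    apply not_countable_univ (α := F)
    have : ((⊤ : Submodule ℚ F) : Set F) = univ := rfl
    rw [← this, ← htop]
    exact hKc
  exact h2 hK.isAlgClosed hK.isSurjectiveOntoUnits hKΓ hKtop hKc (hG hK) hs hs' h hδ

/-- **Zilber fields are generically strongly Γ-closed over every Γ-closed `K ≠ F`, granted
Prop. 11.5** (Bays–Kirby 2018, Prop. 11.5 with the proof of Cor. 11.7: strongly
exponentially-algebraically closed ⟹ exponentially-algebraically closed ⟹ Γ-points Zariski dense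
(Def. 10.3, remark; `BaysKirby2018_gammaPoints_dense_of_isExpAlgClosed_holds`) ⟹ GΓC over `K` ⟹
GSΓC over `K`). [cite: BaysKirby2018ANT, Prop. 11.5, Cor. 11.7 (proof)] -/
theorem IsZilberField.isGenericallyStronglyGammaClosedOver_of_prop_11_5
    (h5 : BaysKirby2018_prop_11_5.{u}) {F : Type u} [Field F] [CharZero F]
    [Literature.ModelTheory.ExponentialFields.ExponentialRing F] (hK : IsZilberField F)
    {K : Submodule ℚ F} (hKΓ : IsGammaClosed K) (hKtop : K ≠ ⊤) :
    IsGenericallyStronglyGammaClosedOver K :=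
  isGenericallyStronglyGammaClosedOver_of_isExpAlgClosed
    BaysKirby2018_gammaPoints_dense_of_isExpAlgClosed_holds h5 hK.isAlgClosed
    hK.isSurjectiveOntoUnits hK.isStronglyExpAlgClosed.isExpAlgClosed hKΓ hKtop

end GenericStrongClosedness

end Literature.NumberTheory.Transcendental
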